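import Mathlib
import HarnessLib

/-!
# `DihedralNormalForm`, line `torus-descent-sum-shadow`, stub `stub_nestedReduction` — Aux 9

Support file for the stub `stub_nestedReduction` (THEOREM N) of the crux `DihedralNormalForm`
(stmt-KontsevichZagierPeriods-3912, route `LinRedNormalForm`): **the combinatorics of the
convergence exponents** `α_{[i,j]} = (j − i) + Σ_{[i',j'] ⊆ [i,j]} e i' j'` (`Nested.alphaS`, written
exactly as in the convergence criterion `atomConvergence`) for PREFIX-NESTED exponent data
(`e i j ≠ 0`, `i < j` only for `i = 0`):
* the effect of changing one exponent (`Nested.alphaS_eadd`);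
* the b-byproduct of the multiplicity-lowering Newton–Leibniz step keeps all `α ≥ 0`
  (`Nested.alphaS_bterm_nonneg`);
* reduced prefix-nested data (kernel exponents `≥ −1`, singleton exponents `≥ 0`) always have
  all `α ≥ 0` (`Nested.alphaS_nonneg_of_reduced`);
* the terminal exponent data `Nested.eP P` of a simple prefix chain.

References: F. Brown, *Mixed Tate motives over ℤ*, Ann. of Math. 175 (2012), §7 (convergence of
the cubical integrals); M. Kontsevich, D. Zagier, *Periods* (2001), §1.2.
-/

namespace Summit.KontsevichZagierPeriods.DihedralNormalForm.TorusDescent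

namespace Nested

open Finset

variable {k m : ℕ}

/-! ## The convergence exponents -/

/-- The convergence exponent of the interval `[i,j]`:
`α_{[i,j]} = (j − i) + Σ_{i ≤ i' ≤ j' ≤ j} e i' j'` (as in `atomConvergence`). -/
def alphaS (e : Fin k → Fin k → ℤ) (i j : Fin k) : ℤ :=
  ((j : ℤ) - (i : ℤ)) + ∑ i' : Fin k, ∑ j' : Fin k, if i ≤ i' ∧ i' ≤ j' ∧ j' ≤ j then e i' j' else 0

/-- The sub-chords of `[i,j]`, as pairs. -/
def sub (i j : Fin k) : Finset (Fin k × Fin k) :=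
  univ.filter fun x => i ≤ x.1 ∧ x.1 ≤ x.2 ∧ x.2 ≤ j

/-- Membership in `sub`. -/
@[simp] theorem mem_sub {i j : Fin k} {x : Fin k × Fin k} :
    x ∈ sub i j ↔ i ≤ x.1 ∧ x.1 ≤ x.2 ∧ x.2 ≤ j := by
  simp [sub]

/-- `α` as a sum over the sub-chords. -/
theorem alphaS_eq (e : Fin k → Fin k → ℤ) (i j : Fin k) :
    alphaS e i j = ((j : ℤ) - (i : ℤ)) + ∑ x ∈ sub i j, e x.1 x.2 := by
  rw [alphaS, sub, sum_filter, ← Fintype.sum_prod_type']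

/-- Changing one exponent: `e + c·δ_{(a,b)}`. -/
def eadd (e : Fin k → Fin k → ℤ) (a b : Fin k) (c : ℤ) : Fin k → Fin k → ℤ :=
  fun i' j' => e i' j' + if i' = a ∧ j' = b then c else 0

/-- Evaluating `eadd`. -/
theorem eadd_apply (e : Fin k → Fin k → ℤ) (a b : Fin k) (c : ℤ) (i' j' : Fin k) :
    eadd e a b c i' j' = e i' j' + if i' = a ∧ j' = b then c else 0 := rfl

/-- **The effect of changing one exponent on `α`.** -/
theorem alphaS_eadd (e : Fin k → Fin k → ℤ) (a b : Fin k) (c : ℤ) (i j : Fin k) :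
    alphaS (eadd e a b c) i j = alphaS e i j + if i ≤ a ∧ a ≤ b ∧ b ≤ j then c else 0 := by
  rw [alphaS_eq, alphaS_eq, add_assoc]
  congr 1
  simp only [eadd_apply, sum_add_distrib]
  congr 1
  rw [← sum_filter]
  by_cases h : i ≤ a ∧ a ≤ b ∧ b ≤ j
  · rw [if_pos h]
    have : (sub i j).filter (fun x : Fin k × Fin k => x.1 = a ∧ x.2 = b) = {(a, b)} := by
      ext x
      simp only [mem_filter, mem_sub, Finset.mem_singleton, Prod.ext_iff]
      constructor
      · exact fun hx => hx.2
      · rintro ⟨rfl, rfl⟩; exact ⟨h, rfl, rfl⟩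
    rw [this, sum_singleton]
  · rw [if_neg h]
    refine sum_eq_zero fun x hx => ?_
    simp only [mem_filter, mem_sub] at hx
    obtain ⟨hx, rfl, rfl⟩ := hx
    exact absurd hx h

/-- The singleton exponent is `α` of the singleton. -/
theorem alphaS_self (e : Fin k → Fin k → ℤ) (l : Fin k) : alphaS e l l = e l l := by
  rw [alphaS_eq, sub_self, zero_add]
  have : sub l l = {(l, l)} := by
    ext x
    simp only [mem_sub, Finset.mem_singleton, Prod.ext_iff]
    constructor
    · rintro ⟨h1, h2, h3⟩
      exact ⟨le_antisymm (h2.trans h3) h1, le_antisymm h3 (h1.trans h2)⟩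
    · rintro ⟨h1, h2⟩
      rw [h1, h2]
      exact ⟨le_rfl, le_rfl, le_rfl⟩
  rw [this, sum_singleton]

/-! ## The b-byproduct of the multiplicity reduction -/

/-- Region split of the sub-chords of `[i,j] ∋ p`: left of `p`, right of `p`, through `p`. -/
theorem sum_sub_split (e : Fin k → Fin k → ℤ) {i j p : Fin k} (hip : i ≤ p) (hpj : p ≤ j) :
    ∑ x ∈ sub i j, e x.1 x.2 =
      (∑ x ∈ (sub i j).filter (fun x => x.2 < p), e x.1 x.2) +
      (∑ x ∈ (sub i j).filter (fun x => p < x.1), e x.1 x.2) +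
      ∑ x ∈ (sub i j).filter (fun x => x.1 ≤ p ∧ p ≤ x.2), e x.1 x.2 := by
  rw [← sum_filter_add_sum_filter_not (sub i j) (fun x => x.2 < p), add_assoc]
  congr 1
  rw [← sum_filter_add_sum_filter_not ((sub i j).filter fun x => ¬ x.2 < p) (fun x => p < x.1),
    filter_filter, filter_filter]
  have hip' := hip; have hpj' := hpj
  congr 1
  · refine sum_congr (filter_congr fun x hx => ?_) fun _ _ => rfl
    rw [mem_sub] at hx
    constructor
    · exact fun h => h.2
    · intro h; exact ⟨not_lt.mpr (h.le.trans hx.2.1), h⟩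
  · refine sum_congr (filter_congr fun x hx => ?_) fun _ _ => rfl
    rw [not_lt, not_lt]
    exact ⟨fun h => ⟨h.2, h.1⟩, fun h => ⟨h.2, h.1⟩⟩

/-- Left region = the sub-chords of `[i, p−1]`. -/
theorem filter_sub_lt {i j p : Fin k} (hip : i < p) (hpj : p ≤ j) :
    (sub i j).filter (fun x => x.2 < p) = sub i ⟨(p : ℕ) - 1, by omega⟩ := by
  ext x
  simp only [mem_filter, mem_sub, Fin.le_def, Fin.lt_def] at *
  omega

/-- Right region = the sub-chords of `[p+1, j]`. -/
theorem filter_sub_gt {i j p : Fin k} (hip : i ≤ p) (hpj : p < j) :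
    (sub i j).filter (fun x => p < x.1) = sub ⟨(p : ℕ) + 1, by omega⟩ j := by
  ext x
  simp only [mem_filter, mem_sub, Fin.le_def, Fin.lt_def] at *
  omega

/-- **The b-byproduct keeps `α ≥ 0`.**  For prefix-nested `e` with all `α ≥ 0`, `p ≠ 0` and
`e p p ≥ 1`: every `[i,j] ∋ p` with `i ≠ 0` has `α_{[i,j]} ≥ 1` (its sub-chords through `p` are
`{p}` and inactive kernel chords). -/
theorem one_le_alphaS_thru {e : Fin k → Fin k → ℤ}
    (hPN : ∀ i j : Fin k, i < j → e i j ≠ 0 → (i : ℕ) = 0)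
    (hα : ∀ i j : Fin k, i ≤ j → 0 ≤ alphaS e i j) {p : Fin k} (hb : 1 ≤ e p p)
    {i j : Fin k} (hip : i ≤ p) (hpj : p ≤ j) (hi : (i : ℕ) ≠ 0) : 1 ≤ alphaS e i j := by
  rw [alphaS_eq, sum_sub_split e hip hpj]
  -- the middle region is the singleton `{p}`
  have hmid : ∑ x ∈ (sub i j).filter (fun x => x.1 ≤ p ∧ p ≤ x.2), e x.1 x.2 = e p p := by
    rw [sum_eq_single (p, p)]
    · rintro ⟨a, b⟩ hx hne
      simp only [mem_filter, mem_sub] at hx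
      by_contra hne0
      have hab : a < b := by
        refine lt_of_le_of_ne hx.1.2.1 fun heq => hne ?_
        subst heq
        have : a = p := le_antisymm hx.2.1 hx.2.2
        subst this
        rfl
      have h0 := hPN a b hab hne0
      have hia : (i : ℕ) ≤ (a : ℕ) := hx.1.1
      omega
    · intro h
      exact absurd (mem_filter.mpr ⟨mem_sub.mpr ⟨hip, le_rfl, hpj⟩, le_rfl, le_rfl⟩) h
  rw [hmid]
  -- the two side regions are `α`'s of shorter intervals
  have hL : ((p : ℤ) - (i : ℤ) - 1) + ∑ x ∈ (sub i j).filter (fun x => x.2 < p), e x.1 x.2 ≥ -1 := by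
    rcases eq_or_lt_of_le hip with rfl | hlt
    · have : (sub i j).filter (fun x => x.2 < i) = ∅ :=
        filter_eq_empty_iff.mpr fun x hx h => by
          rw [mem_sub] at hx; exact absurd (hx.1.trans hx.2.1) (not_le.mpr h)
      rw [this, sum_empty]; omega
    · rw [filter_sub_lt hlt hpj]
      have := hα i ⟨(p : ℕ) - 1, by omega⟩ (by
        rw [Fin.le_def]; simp only; omega)
      rw [alphaS_eq] at this
      have hv : ((⟨(p : ℕ) - 1, by omega⟩ : Fin k) : ℤ) = (p : ℤ) - 1 := by
        simp only
        have : 1 ≤ (p : ℕ) := by omega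
        push_cast [Nat.cast_sub this]
        ring
      rw [hv] at this
      linarith
  have hR : ((j : ℤ) - (p : ℤ) - 1) + ∑ x ∈ (sub i j).filter (fun x => p < x.1), e x.1 x.2 ≥ -1 := by
    rcases eq_or_lt_of_le hpj with rfl | hlt
    · have : (sub i p).filter (fun x => p < x.1) = ∅ :=
        filter_eq_empty_iff.mpr fun x hx h => by
          rw [mem_sub] at hx; exact absurd (hx.2.1.trans hx.2.2) (not_le.mpr h)
      rw [this, sum_empty]; omega
    · rw [filter_sub_gt hip hlt]
      have := hα ⟨(p : ℕ) + 1, by omega⟩ j (by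
        rw [Fin.le_def]; simp only; omega)
      rw [alphaS_eq] at this
      have hv : ((⟨(p : ℕ) + 1, by omega⟩ : Fin k) : ℤ) = (p : ℤ) + 1 := by
        push_cast; ring
      rw [hv] at this
      linarith
  linarith

/-- **The b-byproduct keeps all `α ≥ 0`**: lowering `e p p ≥ 1` by one while raising the exponent
of an active prefix chord `[0, p]`. -/
theorem alphaS_bterm_nonneg {e : Fin k → Fin k → ℤ}
    (hPN : ∀ i j : Fin k, i < j → e i j ≠ 0 → (i : ℕ) = 0)
    (hα : ∀ i j : Fin k, i ≤ j → 0 ≤ alphaS e i j) {z p : Fin k} (hz : (z : ℕ) = 0)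
    (hb : 1 ≤ e p p) (i j : Fin k) (hij : i ≤ j) :
    0 ≤ alphaS (eadd (eadd e z p 1) p p (-1)) i j := by
  rw [alphaS_eadd, alphaS_eadd]
  have hzp : z ≤ p := by rw [Fin.le_def, hz]; exact Nat.zero_le _
  by_cases hthru : i ≤ p ∧ p ≤ j
  · have e2 : (if i ≤ p ∧ p ≤ p ∧ p ≤ j then (-1:ℤ) else 0) = -1 := if_pos ⟨hthru.1, le_rfl, hthru.2⟩
    rw [e2]
    by_cases hi : (i : ℕ) = 0
    · have hiz : i ≤ z := by rw [Fin.le_def, hi, hz]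
      rw [if_pos ⟨hiz, hzp, hthru.2⟩]
      linarith [hα i j hij]
    · have := one_le_alphaS_thru hPN hα hb hthru.1 hthru.2 hi
      split_ifs <;> linarith
  · have e2 : (if i ≤ p ∧ p ≤ p ∧ p ≤ j then (-1:ℤ) else 0) = 0 :=
      if_neg (fun h => hthru ⟨h.1, h.2.2⟩)
    rw [e2, add_zero]
    have := hα i j hij
    split_ifs <;> linarith

/-! ## Reduced prefix-nested data always converge -/

/-- **Reduced data have all `α ≥ 0`.**  If the only non-zero kernel exponents sit on prefix
chords `[0,j]` and are `≥ −1`, and all singleton exponents are `≥ 0`, then every `α_{[i,j]} ≥ 0`: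
at most `j − i` active kernel sub-chords, each contributing `≥ −1`. -/
theorem alphaS_nonneg_of_reduced {e : Fin k → Fin k → ℤ}
    (hPN : ∀ i j : Fin k, i < j → e i j ≠ 0 → (i : ℕ) = 0)
    (hker : ∀ i j : Fin k, i < j → -1 ≤ e i j) (hdiag : ∀ l : Fin k, 0 ≤ e l l)
    (i j : Fin k) (hij : i ≤ j) : 0 ≤ alphaS e i j := by
  rw [alphaS_eq]
  -- compare with the indicator of the kernel sub-chords starting at `i`
  set f : Fin k × Fin k → ℤ := fun x => if x.1 = i ∧ x.1 ≠ x.2 then -1 else 0 with hf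
  have hle : ∑ x ∈ sub i j, f x ≤ ∑ x ∈ sub i j, e x.1 x.2 := by
    refine sum_le_sum fun x hx => ?_
    rw [mem_sub] at hx
    simp only [hf]
    split_ifs with h
    · exact hker _ _ (lt_of_le_of_ne hx.2.1 h.2)
    · rcases eq_or_lt_of_le hx.2.1 with heq | hlt
      · rw [heq]; exact hdiag _
      · by_cases h0 : e x.1 x.2 = 0
        · rw [h0]
        · exfalso
          have h1 := hPN _ _ hlt h0
          refine h ⟨Fin.ext ?_, hlt.ne⟩
          have : (i : ℕ) ≤ x.1 := hx.1
          omega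
  have hcount : ∑ x ∈ sub i j, f x = -(((sub i j).filter fun x => x.1 = i ∧ x.1 ≠ x.2).card : ℤ) := by
    rw [hf, ← sum_filter]
    simp
  have hcard : ((sub i j).filter fun x : Fin k × Fin k => x.1 = i ∧ x.1 ≠ x.2).card ≤ (j : ℕ) - (i : ℕ) := by
    have himage : ((sub i j).filter fun x : Fin k × Fin k => x.1 = i ∧ x.1 ≠ x.2) ⊆
        (Finset.Ioc i j).image fun j' => (i, j') := by
      intro x hx
      simp only [mem_filter, mem_sub] at hx
      rw [Finset.mem_image]
      refine ⟨x.2, Finset.mem_Ioc.mpr ⟨lt_of_le_of_ne (hx.2.1 ▸ hx.1.2.1) (hx.2.1 ▸ hx.2.2), hx.1.2.2⟩, ?_⟩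
      exact Prod.ext hx.2.1.symm rfl
    calc _ ≤ ((Finset.Ioc i j).image fun j' => (i, j')).card := card_le_card himage
      _ ≤ (Finset.Ioc i j).card := card_image_le
      _ = (j : ℕ) - (i : ℕ) := Fin.card_Ioc i j
  have hij' : (i : ℕ) ≤ (j : ℕ) := hij
  have : ((((sub i j).filter fun x : Fin k × Fin k => x.1 = i ∧ x.1 ≠ x.2).card : ℕ) : ℤ) ≤ (j : ℤ) - (i : ℤ) := by
    have := hcard
    omega
  linarith

/-! ## Simple prefix chains -/

/-- The exponent data of the simple prefix chain with right endpoints `P`: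
`e 0 j = −1` for `j ∈ P`, everything else `0`. -/
def eP (P : Finset (Fin (m + 1))) : Fin (m + 1) → Fin (m + 1) → ℤ :=
  fun i j => if (i : ℕ) = 0 ∧ j ∈ P then -1 else 0

/-- Evaluating `eP`. -/
theorem eP_apply (P : Finset (Fin (m + 1))) (i j : Fin (m + 1)) :
    eP P i j = if (i : ℕ) = 0 ∧ j ∈ P then -1 else 0 := rfl

/-- `eP` is prefix-nested. -/
theorem eP_prefix (P : Finset (Fin (m + 1))) (i j : Fin (m + 1)) (_hij : i < j) (h : eP P i j ≠ 0) :
    (i : ℕ) = 0 := by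
  rw [eP_apply] at h
  by_contra hi
  exact h (if_neg fun h' => hi h'.1)

/-- `eP` is reduced: kernel exponents `≥ −1`, singleton exponents `≥ 0` (given `0 ∉ P`). -/
theorem eP_reduced {P : Finset (Fin (m + 1))} (h0 : (0 : Fin (m + 1)) ∉ P) :
    (∀ i j : Fin (m + 1), i < j → -1 ≤ eP P i j) ∧ (∀ l : Fin (m + 1), 0 ≤ eP P l l) := by
  refine ⟨fun i j _ => by rw [eP_apply]; split_ifs <;> norm_num, fun l => ?_⟩
  rw [eP_apply, if_neg]
  rintro ⟨h1, h2⟩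
  have : l = 0 := Fin.ext h1
  exact h0 (this ▸ h2)

/-- Raising the exponent of `[0,p]`, `p ∈ P`, removes `p` from the chain. -/
theorem eadd_eP {P : Finset (Fin (m + 1))} {p : Fin (m + 1)} (hp : p ∈ P) :
    eadd (eP P) 0 p 1 = eP (P.erase p) := by
  funext i j
  rw [eadd_apply, eP_apply, eP_apply]
  by_cases hi : (i : ℕ) = 0
  · have hi0 : i = 0 := Fin.ext hi
    subst hi0
    by_cases hj : j = p
    · subst hj; simp [hp]
    · simp [hj, Finset.mem_erase]
  · have hi0 : i ≠ 0 := fun h => hi (by rw [h]; rfl)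
    simp [hi, hi0]

end Nested

/-- **Registered sub-goal `stub_nestedReductionAux9`**: reduced prefix-nested exponent data satisfy the convergence criterion (`Nested.alphaS_nonneg_of_reduced`). -/
theorem stub_nestedReductionAux9 : ∀ (k : ℕ) (e : Fin k → Fin k → ℤ), (∀ i j : Fin k, i < j → e i j ≠ 0 → (i : ℕ) = 0) → (∀ i j : Fin k, i < j → -1 ≤ e i j) → (∀ l : Fin k, 0 ≤ e l l) → ∀ i j : Fin k, i ≤ j → 0 ≤ ((j : ℤ) - (i : ℤ)) + ∑ i' : Fin k, ∑ j' : Fin k, if i ≤ i' ∧ i' ≤ j' ∧ j' ≤ j then e i' j' else 0 :=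
  fun _ _ h1 h2 h3 i j hij =>
    Nested.alphaS_nonneg_of_reduced h1 h2 h3 i j hij

end Summit.KontsevichZagierPeriods.DihedralNormalForm.TorusDescent
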